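import Literature.Probability.RandomPlanarGeometry.HexSAWStripCurtain
import Literature.Probability.RandomPlanarGeometry.HexSAWStripSurfaceThresholdUnique
import Literature.Probability.RandomPlanarGeometry.HexSAWStripThresholdLinearLower
import HarnessLib

/-!
# Decomposition of a strip bridge at its last leftmost and first rightmost visits: a top-free head, a horizontal
# (Duminil-Copin–Hammond) bridge, and a bottom-free tail — and the first-order bound of `B_T(x_c; y)` at `y_T`
# reduced to the same bound for horizontal bridges

Topic `Literature/Probability/RandomPlanarGeometry` (continues `HexSAWStripCurtain.lean` — the curtain lemma — and the
strip-surface series `HV.stripGFy`, `HV.stripByLim`, `HV.stripZL`, `HV.stripNu`, `HV.stripYT`).  Sources: H. Duminil-Copin,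
S. Smirnov, Ann. Math. 175 (2012) §3 (the strip `S_T`, bridges `a → β`); H. Duminil-Copin, A. Hammond, CMP 324 (2013) §2.2
("a bridge is a walk ω with ω₁(0) < ω₁(i) ≤ ω₁(n)", renewal points — here in the HORIZONTAL direction of the strip, with the
column `ξ` of `HexSAWObservableRot` as the coordinate); N. R. Beaton et al., CMP 326 (2014) §4 and Corollary 8 (`B_T(x_c; y)`,
its radius `y_T`).  Lane «pcv-sawmu», a-p2 g16, `MATHS-NOTE-k1-renewal.md` modules [F] and [A].

## What is proved (namespace `Literature.Probability.RandomPlanarGeometry.SAW.HV`; `x_c = hexCriticalFugacity`)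

* `mirrorX` — the reflection `(x₀, x₁, b) ↦ (−x₀ − x₁ − b, x₁, b)` of `ℍ` in the vertical axis through `a`: a graph automorphism
  fixing `hvOrigin`, keeping levels, `ξ ↦ −ξ`, mapping every `stripV T L` onto itself.
* Horizontal bridges `IsHBridge` (`ξ(head) < ξ(v) ≤ ξ(last)` for every later vertex), the finite classes `hBridgesN T N`
  (self-avoiding, in the strip, standard head, at most `N + 1` vertices) and their weighted sums `hBridgeSumN T N y`.
* The end classes: `topFreeN T N` (walks from `O` whose vertices except the last avoid the top level) with `topFreeSumN`, and
  `botFreeN T N` (walks from a standard head, ending on the top level, whose vertices except the first avoid the bottom level)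
  with `botFreeSumN`; ★ their sums are BOUNDED uniformly in `N`: `exists_topFreeSumN_le` (at every `y`), `exists_botFreeSumN_le`
  (at every `1 ≤ y` with `x_c ν_{T−1}(y) < 1`, in particular at `y = y_T` since `y_T < y_{T−1}`) — a walk avoiding one wall lives
  in a strip of width `T − 1` (`two_le_lev_aux`: a level-one vertex has a single neighbour off the bottom).
* The extremal indices `sIdx` (LAST leftmost), `tIdx` (last rightmost), `t1Idx` (first rightmost after `sIdx`) of a list and
  the three pieces `headP = l[0..s]`, `midP = l[s..t₁]`, `tailP = l[t₁..]`; ★ the two CURTAIN ARGUMENTS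
  `lev_ne_top_of_lt_sIdx` (before the last leftmost visit a bridge list has no top vertex) and `lev_ne_zero_of_t1Idx_lt` (after
  the first rightmost visit it has no bottom vertex) — else the passage from the leftmost to the rightmost column would by-pass a
  bottom-to-top curtain (`curtain_lemma`); `isHBridge_midP`; memberships `headP_mem_topFreeN`, `xstd_midP_mem_hBridgesN`,
  `xstd_tailP_mem_botFreeN`; the weight identity `wt_eq_tripleWt_decTriple` and ★ injectivity `decTriple_injOn`.
* `sum_caseA_le` — the case `sIdx < tIdx` weighs at most `F₁ · D · F₃`; `sum_caseB_le_sum_caseA` — the mirror maps the other case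
  injectively into this one; ★ `stripGFy_beta_le_two_mul`: `B_{T,L}(x_c; y) ≤ 2 F₁ D_N(y) F₃(y)` (`N + 1 ≥ |V(S_{T,L})|`).
* ★★ `stripByLim_mul_sub_le_of_hBridge_bound` — for `T ≥ 2`: IF the truncated horizontal-bridge series obey
  `D_N(y) ≤ C/(y_T − y)` on `[1, y_T)` uniformly in `N` (the renewal structure: lane module [D] + the tree-bound
  `Literature.Analysis.Matrix.NonnegMatrixFamilyNeumannBound`), THEN `B_T(x_c; y) · (y_T − y) ≤ A` on `[1, y_T)` — the lane's (P),
  whence (module [D], `HexSAWStripBridgeRenewal.lean`, which also discharges the hypothesis) the linear upper law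
  `B_{T,L}(x_c; y_T) = O(L)`.  The hypothesis is an explicit binder, not a named fact; nothing printed is claimed beyond the cited
  settings (pointwise boundedness of `β_{T,m} y_T^m` is NOT asserted here).
-/

noncomputable section

open Finset Literature.Probability.LatticeModels Literature.Probability.Percolation

namespace Literature.Probability.RandomPlanarGeometry.SAW

namespace HV

/-! ### §1 The mirror in the vertical axis -/

/-- The reflection of `ℍ` in the vertical line through the mid-edge `a`: `(x₀, x₁, b) ↦ (−x₀ − x₁ − b, x₁, b)`.
[cite: DuminilCopinSmirnov2012, §3 (Fig. 3: the domain S_{T,L} is symmetric)] -/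
def mirrorX : hvGraph ≃g hvGraph where
  toEquiv :=
    { toFun := fun v => (-v.1 - v.2.1 - bit v, v.2.1, v.2.2)
      invFun := fun v => (-v.1 - v.2.1 - bit v, v.2.1, v.2.2)
      left_inv := fun v => by obtain ⟨a, b, c⟩ := v; (cases c <;> simp [bit]); all_goals omega
      right_inv := fun v => by obtain ⟨a, b, c⟩ := v; (cases c <;> simp [bit]); all_goals omega }
  map_rel_iff' := by
    rintro ⟨x, y, c⟩ ⟨x', y', c'⟩
    cases c <;> cases c' <;> simp [hvGraph_adj, AdjRel, bit] <;> omega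

/-- `mirrorX` in coordinates. [cite: DuminilCopinSmirnov2012, §3 (Fig. 3)] -/
@[simp] theorem mirrorX_apply (v : HV) : mirrorX v = (-v.1 - v.2.1 - bit v, v.2.1, v.2.2) := rfl

/-- `mirrorX` keeps levels. [cite: DuminilCopinSmirnov2012, §3 (Fig. 3)] -/
@[simp] theorem lev_mirrorX (v : HV) : lev (mirrorX v) = lev v := by
  obtain ⟨a, b, c⟩ := v; cases c <;> simp [bit]

/-- `mirrorX` negates the column. [cite: DuminilCopinSmirnov2012, §3 (Fig. 3)] -/
@[simp] theorem xi_mirrorX (v : HV) : xi (mirrorX v) = -xi v := by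
  obtain ⟨a, b, c⟩ := v; (cases c <;> simp [xi, bit]); all_goals omega

/-- `mirrorX` is an involution. [cite: DuminilCopinSmirnov2012, §3 (Fig. 3)] -/
@[simp] theorem mirrorX_mirrorX (v : HV) : mirrorX (mirrorX v) = v := by
  obtain ⟨a, b, c⟩ := v; (cases c <;> simp [bit]); all_goals omega

/-- `mirrorX` fixes the origin. [cite: DuminilCopinSmirnov2012, §3 (Fig. 3)] -/
@[simp] theorem mirrorX_hvOrigin : mirrorX hvOrigin = hvOrigin := by simp [hvOrigin, bit]

/-- `mirrorX` maps `V(S_{T,L})` onto itself. [cite: DuminilCopinSmirnov2012, §3 (Fig. 3: S_{T,L} is symmetric under the reflection fixing a)] -/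
theorem mirrorX_mem_stripV {T L : ℕ} {v : HV} (hv : v ∈ stripV T L) : mirrorX v ∈ stripV T L := by
  obtain ⟨a, b, c⟩ := v
  rw [mem_stripV_iff] at hv ⊢
  cases c <;> simp [bit] at hv ⊢ <;> omega

/-! ### §2 Horizontal bridges -/

/-- A list is a **horizontal bridge** (Duminil-Copin–Hammond convention, along the column `ξ`): every vertex after the head has a
column strictly larger than the head's and at most the last vertex's. [cite: DuminilCopinHammond2013, §2.2 (bridges: ω₁(0) < ω₁(i) ≤ ω₁(n))] -/
def IsHBridge (l : List HV) : Prop :=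
  ∃ h : l ≠ [], ∀ v ∈ l.tail, xi (l.head h) < xi v ∧ xi v ≤ xi (l.getLast h)

/-- Being a horizontal bridge is decidable (plumbing). [folklore] -/
instance (l : List HV) : Decidable (IsHBridge l) := by unfold IsHBridge; infer_instance

/-- The **horizontal bridges of `S_T` with standard head and at most `N + 1` vertices** (one per translation class).
[cite: DuminilCopinHammond2013, §2.2; DuminilCopinSmirnov2012, §3 (the strip S_T)] -/
def hBridgesN (T N : ℕ) : Finset (List HV) :=
  ((Finset.range (N + 1)).biUnion fun n => stripChains T n).filter fun l => IsHBridge l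

/-- **The truncated horizontal-bridge series** `Σ_{h} x_c^{|h|} y^{#top(h)}` over `hBridgesN T N`.
[cite: BeatonBousquetMelouDeGierDuminilCopinGuttmann2014, §4 (strip series at x = x_c with surface fugacity y); lane] -/
def hBridgeSumN (T N : ℕ) (y : ℝ) : ℝ :=
  ∑ l ∈ hBridgesN T N, hexCriticalFugacity ^ l.length * y ^ topCnt T l

/-- The truncated horizontal-bridge series is non-negative for `y ≥ 0`. [cite: BeatonBousquetMelouDeGierDuminilCopinGuttmann2014, §4] -/
theorem hBridgeSumN_nonneg (T N : ℕ) {y : ℝ} (hy : 0 ≤ y) : 0 ≤ hBridgeSumN T N y :=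
  sum_nonneg fun _ _ => mul_nonneg (pow_nonneg hexCriticalFugacity_pos_lt_one.1.le _) (pow_nonneg hy _)

/-! ### §3 The end classes and their finiteness -/

/-- **Top-free heads**: self-avoiding lists of `S_T` from the origin with at most `N + 1` vertices whose vertices except possibly
the last avoid the top level `2T − 1`. [cite: DuminilCopinSmirnov2012, §3 (the strip S_T); lane (MATHS-NOTE-k1-renewal [F])] -/
def topFreeN (T N : ℕ) : Finset (List HV) :=
  ((Finset.range (N + 1)).biUnion fun n => stripChains T n).filter
    fun l => l.head? = some hvOrigin ∧ topCnt T l.dropLast = 0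

/-- The weighted sum of the top-free heads: `Σ x_c^{|q| − 1}` (the last vertex is weighted with the next piece).
[cite: BeatonBousquetMelouDeGierDuminilCopinGuttmann2014, §4; lane] -/
def topFreeSumN (T N : ℕ) : ℝ :=
  ∑ l ∈ topFreeN T N, hexCriticalFugacity ^ (l.length - 1)

/-- **Bottom-free tails**: self-avoiding lists of `S_T` with standard head and at most `N + 1` vertices, ending on the top level,
whose vertices except possibly the first avoid the bottom level `0`. [cite: DuminilCopinSmirnov2012, §3; lane (MATHS-NOTE-k1-renewal [F])] -/
def botFreeN (T N : ℕ) : Finset (List HV) :=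
  ((Finset.range (N + 1)).biUnion fun n => stripChains T n).filter
    fun l => (∀ v ∈ l.tail, lev v ≠ 0) ∧ lev (l.getLast?.getD hvOrigin) = 2 * (T : ℤ) - 1

/-- The weighted sum of the bottom-free tails: `Σ x_c^{|r| − 1} y^{#top(r.tail)}`. [cite: BeatonBousquetMelouDeGierDuminilCopinGuttmann2014, §4; lane] -/
def botFreeSumN (T N : ℕ) (y : ℝ) : ℝ :=
  ∑ l ∈ botFreeN T N, hexCriticalFugacity ^ (l.length - 1) * y ^ topCnt T l.tail


/-! ### §4 Extremal columns of a list: the last leftmost index, the last and the first-after rightmost indices -/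

section Indices

/-- The column of the `j`-th vertex of a list (junk `0` beyond its end). [folklore] -/
def xiAt (l : List HV) (j : ℕ) : ℤ := xi (l.getD j hvOrigin)

/-- The indices where the column is minimal (plumbing). [folklore] -/
def minIdxs (l : List HV) : Finset ℕ := (range l.length).filter fun j => ∀ i ∈ range l.length, xiAt l j ≤ xiAt l i

/-- The indices where the column is maximal (plumbing). [folklore] -/
def maxIdxs (l : List HV) : Finset ℕ := (range l.length).filter fun j => ∀ i ∈ range l.length, xiAt l i ≤ xiAt l j

/-- The LAST index where the column is minimal (junk `0` for the empty list). [folklore] -/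
def sIdx (l : List HV) : ℕ := if h : (minIdxs l).Nonempty then (minIdxs l).max' h else 0

/-- The LAST index where the column is maximal (junk `0` for the empty list). [folklore] -/
def tIdx (l : List HV) : ℕ := if h : (maxIdxs l).Nonempty then (maxIdxs l).max' h else 0

/-- The FIRST index after `sIdx` where the column is maximal (junk `0` if there is none). [folklore] -/
def t1Idx (l : List HV) : ℕ :=
  if h : ((maxIdxs l).filter fun j => sIdx l < j).Nonempty then ((maxIdxs l).filter fun j => sIdx l < j).min' h else 0

variable {l : List HV}

/-- `xiAt` at an index is the column of that vertex. [cite: DuminilCopinHammond2013, §2.2 (bridge decomposition: bookkeeping of indices and pieces); lane plumbing] -/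
theorem xiAt_eq_xi_getElem {j : ℕ} (hj : j < l.length) : xiAt l j = xi l[j] := by
  rw [xiAt, List.getD_eq_getElem _ _ hj]

/-- The argmin set of a nonempty list is nonempty. [cite: DuminilCopinHammond2013, §2.2 (bridge decomposition: bookkeeping of indices and pieces); lane plumbing] -/
theorem minIdxs_nonempty (hl : l ≠ []) : (minIdxs l).Nonempty := by
  have hne : (range l.length).Nonempty := ⟨0, mem_range.2 (List.length_pos_of_ne_nil hl)⟩
  obtain ⟨j, hj, hmin⟩ := (range l.length).exists_min_image (xiAt l) hne
  exact ⟨j, mem_filter.2 ⟨hj, hmin⟩⟩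

/-- The argmax set of a nonempty list is nonempty. [cite: DuminilCopinHammond2013, §2.2 (bridge decomposition: bookkeeping of indices and pieces); lane plumbing] -/
theorem maxIdxs_nonempty (hl : l ≠ []) : (maxIdxs l).Nonempty := by
  have hne : (range l.length).Nonempty := ⟨0, mem_range.2 (List.length_pos_of_ne_nil hl)⟩
  obtain ⟨j, hj, hmax⟩ := (range l.length).exists_max_image (xiAt l) hne
  exact ⟨j, mem_filter.2 ⟨hj, hmax⟩⟩

/-- `sIdx` is an index of minimal column, and the last one. [cite: DuminilCopinHammond2013, §2.2 (bridge decomposition: bookkeeping of indices and pieces); lane plumbing] -/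
theorem sIdx_spec (hl : l ≠ []) :
    sIdx l < l.length ∧ (∀ i < l.length, xiAt l (sIdx l) ≤ xiAt l i) ∧
      ∀ j < l.length, (∀ i < l.length, xiAt l j ≤ xiAt l i) → j ≤ sIdx l := by
  have hne := minIdxs_nonempty hl
  have hs : sIdx l = (minIdxs l).max' hne := by rw [sIdx, dif_pos hne]
  have hmem := (minIdxs l).max'_mem hne
  rw [← hs, minIdxs, mem_filter, mem_range] at hmem
  refine ⟨hmem.1, fun i hi => hmem.2 i (mem_range.2 hi), fun j hj hmin => ?_⟩
  rw [hs]
  exact (minIdxs l).le_max' j (mem_filter.2 ⟨mem_range.2 hj, fun i hi => hmin i (mem_range.1 hi)⟩)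

/-- `tIdx` is an index of maximal column, and the last one. [cite: DuminilCopinHammond2013, §2.2 (bridge decomposition: bookkeeping of indices and pieces); lane plumbing] -/
theorem tIdx_spec (hl : l ≠ []) :
    tIdx l < l.length ∧ (∀ i < l.length, xiAt l i ≤ xiAt l (tIdx l)) ∧
      ∀ j < l.length, (∀ i < l.length, xiAt l i ≤ xiAt l j) → j ≤ tIdx l := by
  have hne := maxIdxs_nonempty hl
  have ht : tIdx l = (maxIdxs l).max' hne := by rw [tIdx, dif_pos hne]
  have hmem := (maxIdxs l).max'_mem hne
  rw [← ht, maxIdxs, mem_filter, mem_range] at hmem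
  refine ⟨hmem.1, fun i hi => hmem.2 i (mem_range.2 hi), fun j hj hmax => ?_⟩
  rw [ht]
  exact (maxIdxs l).le_max' j (mem_filter.2 ⟨mem_range.2 hj, fun i hi => hmax i (mem_range.1 hi)⟩)

/-- After the last leftmost index the column is strictly larger. [cite: DuminilCopinHammond2013, §2.2 (bridge decomposition: bookkeeping of indices and pieces); lane plumbing] -/
theorem xiAt_sIdx_lt (hl : l ≠ []) {j : ℕ} (hj : j < l.length) (hsj : sIdx l < j) : xiAt l (sIdx l) < xiAt l j := by
  obtain ⟨-, hmin, hlast⟩ := sIdx_spec hl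
  refine lt_of_le_of_ne (hmin j hj) fun heq => ?_
  have := hlast j hj fun i hi => heq ▸ hmin i hi
  omega

/-- In case `sIdx < tIdx`: `t1Idx` is an index of maximal column, after `sIdx`, at most `tIdx`, and the first such. [cite: DuminilCopinHammond2013, §2.2 (bridge decomposition: bookkeeping of indices and pieces); lane plumbing] -/
theorem t1Idx_spec (hl : l ≠ []) (hst : sIdx l < tIdx l) :
    sIdx l < t1Idx l ∧ t1Idx l ≤ tIdx l ∧ t1Idx l < l.length ∧ (∀ i < l.length, xiAt l i ≤ xiAt l (t1Idx l)) ∧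
      ∀ j, sIdx l < j → j < t1Idx l → ¬ ∀ i < l.length, xiAt l i ≤ xiAt l j := by
  obtain ⟨htl, htmax, htlast⟩ := tIdx_spec hl
  set F := (maxIdxs l).filter fun j => sIdx l < j with hF
  have htF : tIdx l ∈ F := mem_filter.2 ⟨mem_filter.2 ⟨mem_range.2 htl, fun i hi => htmax i (mem_range.1 hi)⟩, hst⟩
  have hne : F.Nonempty := ⟨_, htF⟩
  have h1 : t1Idx l = F.min' hne := by rw [t1Idx, ← hF, dif_pos hne]
  have hmem := F.min'_mem hne
  rw [← h1, hF, mem_filter, maxIdxs, mem_filter, mem_range] at hmem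
  refine ⟨hmem.2, ?_, hmem.1.1, fun i hi => hmem.1.2 i (mem_range.2 hi), fun j hsj hjt hmax => ?_⟩
  · rw [h1]; exact F.min'_le _ htF
  · have hjF : j ∈ F := mem_filter.2 ⟨mem_filter.2 ⟨mem_range.2 (by omega), fun i hi => hmax i (mem_range.1 hi)⟩, hsj⟩
    have := F.min'_le j hjF
    rw [← h1] at this
    omega

/-- For a bridge list (from `O`, at least two vertices, inside the strip) the extremal columns differ, so `sIdx ≠ tIdx`.
[cite: DuminilCopinSmirnov2012, §3 (a enters the strip at its lower boundary)] -/
theorem sIdx_ne_tIdx {T L : ℕ} (hc : l.IsChain hvGraph.Adj) (hh : l.head? = some hvOrigin) (hV : ∀ v ∈ l, v ∈ stripV T L)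
    (h2 : 2 ≤ l.length) : sIdx l ≠ tIdx l := by
  intro hst
  have hl : l ≠ [] := by rintro rfl; simp at h2
  obtain ⟨hs, hmin, -⟩ := sIdx_spec hl
  obtain ⟨ht, hmax, -⟩ := tIdx_spec hl
  -- all columns are equal
  have hconst : ∀ i < l.length, xiAt l i = xiAt l 0 := fun i hi => by
    have h0 := List.length_pos_of_ne_nil hl
    have a1 := hmin i hi; have a2 := hmax i hi; have a3 := hmin 0 h0; have a4 := hmax 0 h0
    rw [hst] at a1 a3; omega
  -- but the first step from `O` changes the column
  obtain ⟨v, w, rest, rfl⟩ : ∃ v w rest, l = v :: w :: rest := by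
    match l, h2 with
    | v :: w :: rest, _ => exact ⟨v, w, rest, rfl⟩
  have hv : v = hvOrigin := by simpa using hh
  subst hv
  have hadj : hvGraph.Adj hvOrigin w := (List.isChain_cons_cons.1 hc).1
  have hw : w ∈ stripV T L := hV w (by simp)
  have h1 := hconst 1 (by simp)
  simp only [xiAt, List.getD_cons_succ, List.getD_cons_zero, xi_hvOrigin] at h1
  obtain ⟨a, b, c⟩ := w
  rw [mem_stripV_iff] at hw
  (cases c <;> simp [hvGraph_adj, AdjRel, hvOrigin, xi, bit] at hadj h1 hw); all_goals omega

end Indices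


/-! ### §5 The three pieces of a bridge list and the two curtain arguments -/

section Pieces

variable {T L : ℕ} {l : List HV}

/-- The head piece `l[0 .. s]` up to the last leftmost vertex (plumbing). [folklore] -/
def headP (l : List HV) : List HV := l.take (sIdx l + 1)

/-- The middle piece `l[s .. t₁]` from the last leftmost vertex to the first rightmost vertex after it (plumbing). [folklore] -/
def midP (l : List HV) : List HV := (l.take (t1Idx l + 1)).drop (sIdx l)

/-- The tail piece `l[t₁ ..]` from that rightmost vertex to the end (plumbing). [folklore] -/
def tailP (l : List HV) : List HV := l.drop (t1Idx l)

/-- The last vertex of `l.take (i+1)` is `l[i]`. [cite: DuminilCopinHammond2013, §2.2 (bridge decomposition: bookkeeping of indices and pieces); lane plumbing] -/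
theorem getLast_take_succ {i : ℕ} (hi : i < l.length) (h : l.take (i + 1) ≠ []) : (l.take (i + 1)).getLast h = l[i] := by
  rw [List.getLast_eq_getElem]
  simp only [List.length_take, List.getElem_take]
  congr 1
  omega

/-- Every member of `l` is some `l[i]`, and then its column is `xiAt l i`. [cite: DuminilCopinHammond2013, §2.2 (bridge decomposition: bookkeeping of indices and pieces); lane plumbing] -/
theorem exists_xiAt_of_mem {v : HV} (hv : v ∈ l) : ∃ i, i < l.length ∧ xi v = xiAt l i := by
  obtain ⟨i, hi, rfl⟩ := List.mem_iff_getElem.1 hv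
  exact ⟨i, hi, (xiAt_eq_xi_getElem hi).symm⟩

/-- A vertex of a list contained in a strip domain has level in `[0, 2T−1]`. [cite: DuminilCopinSmirnov2012, §3 (the strip S_T)] -/
theorem lev_bounds_of_mem_stripV {v : HV} (hv : v ∈ stripV T L) : 0 ≤ lev v ∧ lev v ≤ 2 * (T : ℤ) - 1 := by
  obtain ⟨a, b, c⟩ := v
  rw [mem_stripV_iff] at hv
  cases c <;> simp [bit] at hv ⊢ <;> omega

/-- **Curtain argument at the right end.**  For a self-avoiding list from `O` to the top level with `sIdx < tIdx`: after the index
`t₁ = t1Idx` no vertex is on the bottom level (the piece `l[s .. t₁]`, from the leftmost to the rightmost column, would by-pass the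
bottom-to-top curtain `l[j ..]`). [cite: DuminilCopinSmirnov2012, §3 (the strip S_T); lane (MATHS-NOTE-k1-renewal [A](3))] -/
theorem lev_ne_zero_of_t1Idx_lt (hc : l.IsChain hvGraph.Adj) (hnd : l.Nodup) (hV : ∀ v ∈ l, v ∈ stripV T L)
    {hl : l ≠ []} (hlast : lev (l.getLast hl) = 2 * (T : ℤ) - 1) (hst : sIdx l < tIdx l)
    {j : ℕ} (hj : j < l.length) (hj1 : t1Idx l < j) : lev l[j] ≠ 0 := by
  intro h0
  obtain ⟨hs1, ht1t, ht1l, hmax1, -⟩ := t1Idx_spec hl hst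
  obtain ⟨hsl, hmin, -⟩ := sIdx_spec hl
  set s := sIdx l
  set t₁ := t1Idx l
  -- the curtain `K = l[j ..]`
  have hKne : l.drop j ≠ [] := by simp [List.drop_eq_nil_iff]; omega
  have hK0 : lev ((l.drop j).head hKne) = 0 := by rwa [List.head_drop]
  have hKn : lev ((l.drop j).getLast hKne) = 2 * (T : ℤ) - 1 := by rwa [List.getLast_drop]
  -- the by-pass `P = l[s .. t₁]`
  have hPne : (l.take (t₁ + 1)).drop s ≠ [] := by simp [List.drop_eq_nil_iff, List.length_take]; omega
  have hPsub : (l.take (t₁ + 1)).drop s ⊆ l.take (t₁ + 1) := (List.drop_sublist _ _).subset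
  refine curtain_lemma (T := T) (hc.drop j) hKne hK0 hKn ((hc.take (t₁ + 1)).drop s) hPne ?_ ?_ ?_ ?_
  · intro p hp
    exact lev_bounds_of_mem_stripV (hV p ((List.take_sublist _ _).subset (hPsub hp)))
  · intro p hp hpK
    exact (List.disjoint_take_drop hnd (show t₁ + 1 ≤ j by omega)) (hPsub hp) hpK
  · intro k hk
    rw [List.head_drop, List.getElem_take, ← xiAt_eq_xi_getElem hsl]
    obtain ⟨i, hi, hxi⟩ := exists_xiAt_of_mem ((List.drop_sublist _ _).subset hk)
    rw [hxi]; exact hmin i hi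
  · intro k hk
    rw [List.getLast_drop, getLast_take_succ ht1l, ← xiAt_eq_xi_getElem ht1l]
    obtain ⟨i, hi, hxi⟩ := exists_xiAt_of_mem ((List.drop_sublist _ _).subset hk)
    rw [hxi]; exact hmax1 i hi

/-- **Curtain argument at the left end.**  For a self-avoiding list from `O` with `sIdx < tIdx`: before the index `s = sIdx` no
vertex is on the top level (the piece `l[s .. t]`, `t = tIdx`, would by-pass the curtain `l[0 .. j]`).
[cite: DuminilCopinSmirnov2012, §3 (the strip S_T); lane (MATHS-NOTE-k1-renewal [A](1))] -/
theorem lev_ne_top_of_lt_sIdx (hc : l.IsChain hvGraph.Adj) (hnd : l.Nodup) (hV : ∀ v ∈ l, v ∈ stripV T L)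
    (hh : l.head? = some hvOrigin) (hst : sIdx l < tIdx l) {j : ℕ} (hjl : j < l.length) (hj : j < sIdx l) :
    lev l[j] ≠ 2 * (T : ℤ) - 1 := by
  have hl : l ≠ [] := by rintro rfl; simp at hh
  intro htop
  obtain ⟨hsl, hmin, -⟩ := sIdx_spec hl
  obtain ⟨htl, hmax, -⟩ := tIdx_spec hl
  set s := sIdx l
  set t := tIdx l
  -- the curtain `K = l[0 .. j]`
  have hKne : l.take (j + 1) ≠ [] := by simp [List.take_eq_nil_iff, hl]
  have hK0 : lev ((l.take (j + 1)).head hKne) = 0 := by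
    rw [List.head_take, (List.head_eq_iff_head?_eq_some _).2 hh, lev_hvOrigin]
  have hKn : lev ((l.take (j + 1)).getLast hKne) = 2 * (T : ℤ) - 1 := by rwa [getLast_take_succ (by omega)]
  -- the by-pass `P = l[s .. t]`
  have hPne : (l.take (t + 1)).drop s ≠ [] := by simp [List.drop_eq_nil_iff, List.length_take]; omega
  have hPsub : (l.take (t + 1)).drop s ⊆ l.drop s := by
    rw [List.drop_take]; exact (List.take_sublist _ _).subset
  refine curtain_lemma (T := T) (hc.take (j + 1)) hKne hK0 hKn ((hc.take (t + 1)).drop s) hPne ?_ ?_ ?_ ?_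
  · intro p hp
    exact lev_bounds_of_mem_stripV (hV p ((List.drop_sublist _ _).subset (hPsub hp)))
  · intro p hp hpK
    exact (List.disjoint_take_drop hnd (show j + 1 ≤ s by omega)) hpK (hPsub hp)
  · intro k hk
    rw [List.head_drop, List.getElem_take, ← xiAt_eq_xi_getElem hsl]
    obtain ⟨i, hi, hxi⟩ := exists_xiAt_of_mem ((List.take_sublist _ _).subset hk)
    rw [hxi]; exact hmin i hi
  · intro k hk
    rw [List.getLast_drop, getLast_take_succ htl, ← xiAt_eq_xi_getElem htl]
    obtain ⟨i, hi, hxi⟩ := exists_xiAt_of_mem ((List.take_sublist _ _).subset hk)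
    rw [hxi]; exact hmax i hi

end Pieces


/-! ### §6 The pieces: identities, memberships, weights, injectivity -/

section Decomposition

variable {T L : ℕ} {l : List HV}

/-- The column is shift-covariant: `ξ(v + (a, 0)) = ξ(v) + 2a`. [cite: Beaton2014RotatedHoneycomb, §2 (Fig. 1(b))] -/
@[simp] theorem xi_shift_zero (a : ℤ) (v : HV) : xi (shift a 0 v) = xi v + 2 * a := by
  obtain ⟨x, y, c⟩ := v; simp [xi, bit]; ring

/-- Horizontal bridges are translation invariant. [cite: DuminilCopinHammond2013, §2.2] -/
theorem isHBridge_map_shift {l : List HV} (a : ℤ) (h : IsHBridge l) : IsHBridge (l.map (shift a 0)) := by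
  obtain ⟨hne, hb⟩ := h
  refine ⟨by simpa using hne, fun v hv => ?_⟩
  rw [← List.map_tail, List.mem_map] at hv
  obtain ⟨w, hw, rfl⟩ := hv
  rw [List.head_map, List.getLast_map, xi_shift_zero, xi_shift_zero, xi_shift_zero]
  have := hb w hw
  constructor <;> linarith [this.1, this.2]

/-- `xstd` keeps horizontal bridges. [cite: DuminilCopinHammond2013, §2.2] -/
theorem isHBridge_xstd {l : List HV} (h : IsHBridge l) : IsHBridge (xstd l) := isHBridge_map_shift _ h

/-- `l[0 .. s−1] ++ l[s .. t₁] = l[0 .. t₁]`. [cite: DuminilCopinHammond2013, §2.2 (bridge decomposition: bookkeeping of indices and pieces); lane plumbing] -/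
theorem take_sIdx_append_midP (hl : l ≠ []) (hst : sIdx l < tIdx l) :
    l.take (sIdx l) ++ midP l = l.take (t1Idx l + 1) := by
  obtain ⟨hs1, -, -, -, -⟩ := t1Idx_spec hl hst
  have h1 : l.take (sIdx l) = (l.take (t1Idx l + 1)).take (sIdx l) := by
    rw [List.take_take, Nat.min_eq_left (by omega)]
  rw [h1, midP, List.take_append_drop]

/-- `l[0 .. s−1] ++ l[s .. t₁] ++ l[t₁+1 ..] = l`. [cite: DuminilCopinHammond2013, §2.2 (bridge decomposition: bookkeeping of indices and pieces); lane plumbing] -/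
theorem take_sIdx_append_midP_append (hl : l ≠ []) (hst : sIdx l < tIdx l) :
    l.take (sIdx l) ++ midP l ++ (tailP l).tail = l := by
  rw [take_sIdx_append_midP hl hst, tailP, List.tail_drop, List.take_append_drop]

/-- The lengths of the pieces. [cite: DuminilCopinHammond2013, §2.2 (bridge decomposition: bookkeeping of indices and pieces); lane plumbing] -/
theorem length_pieces (hl : l ≠ []) (hst : sIdx l < tIdx l) :
    (headP l).length = sIdx l + 1 ∧ (midP l).length = t1Idx l + 1 - sIdx l ∧ (tailP l).length = l.length - t1Idx l := by
  obtain ⟨hs1, -, ht1l, -, -⟩ := t1Idx_spec hl hst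
  refine ⟨?_, ?_, ?_⟩
  · rw [headP, List.length_take]; omega
  · rw [midP, List.length_drop, List.length_take]; omega
  · rw [tailP, List.length_drop]

/-- The head of the middle piece is `l[s]`. [cite: DuminilCopinHammond2013, §2.2 (bridge decomposition: bookkeeping of indices and pieces); lane plumbing] -/
theorem head_midP (hl : l ≠ []) (h : midP l ≠ []) :
    (midP l).head h = l[sIdx l]'(sIdx_spec hl).1 := by
  simp only [midP, List.head_drop, List.getElem_take]

/-- The last vertex of the middle piece is `l[t₁]`. [cite: DuminilCopinHammond2013, §2.2 (bridge decomposition: bookkeeping of indices and pieces); lane plumbing] -/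
theorem getLast_midP (hl : l ≠ []) (hst : sIdx l < tIdx l) (h : midP l ≠ []) :
    (midP l).getLast h = l[t1Idx l]'(t1Idx_spec hl hst).2.2.1 := by
  change ((l.take (t1Idx l + 1)).drop (sIdx l)).getLast h = _
  rw [List.getLast_drop, getLast_take_succ (t1Idx_spec hl hst).2.2.1]

/-- The middle piece is nonempty. [cite: DuminilCopinHammond2013, §2.2 (bridge decomposition: bookkeeping of indices and pieces); lane plumbing] -/
theorem midP_ne_nil (hl : l ≠ []) (hst : sIdx l < tIdx l) : midP l ≠ [] := by
  obtain ⟨hs1, -, ht1l, -, -⟩ := t1Idx_spec hl hst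
  intro h
  have := congrArg List.length h
  rw [(length_pieces hl hst).2.1] at this
  simp at this; omega

/-- ★ The middle piece is a horizontal bridge. [cite: DuminilCopinHammond2013, §2.2 (bridges); lane (MATHS-NOTE-k1-renewal [A](2))] -/
theorem isHBridge_midP (hl : l ≠ []) (hst : sIdx l < tIdx l) : IsHBridge (midP l) := by
  obtain ⟨hs1, ht1t, ht1l, hmax1, -⟩ := t1Idx_spec hl hst
  obtain ⟨hsl, hmin, -⟩ := sIdx_spec hl
  refine ⟨midP_ne_nil hl hst, fun v hv => ?_⟩
  rw [head_midP hl, getLast_midP hl hst, ← xiAt_eq_xi_getElem hsl, ← xiAt_eq_xi_getElem ht1l]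
  rw [midP, List.tail_drop, List.mem_drop_iff_getElem] at hv
  obtain ⟨j, hj, rfl⟩ := hv
  rw [List.length_take] at hj
  rw [List.getElem_take, ← xiAt_eq_xi_getElem (by omega)]
  exact ⟨xiAt_sIdx_lt hl (by omega) (by omega), hmax1 _ (by omega)⟩

/-- The head piece has no vertex on the top level except possibly its last one. [cite: DuminilCopinSmirnov2012, §3; lane (MATHS-NOTE-k1-renewal [A](1))] -/
theorem topCnt_take_sIdx_eq_zero (hc : l.IsChain hvGraph.Adj) (hnd : l.Nodup) (hV : ∀ v ∈ l, v ∈ stripV T L)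
    (hh : l.head? = some hvOrigin) (hst : sIdx l < tIdx l) : topCnt T (l.take (sIdx l)) = 0 := by
  rw [topCnt, List.length_eq_zero_iff, List.filter_eq_nil_iff]
  intro v hv
  rw [List.mem_take_iff_getElem] at hv
  obtain ⟨j, hj, rfl⟩ := hv
  simpa using lev_ne_top_of_lt_sIdx hc hnd hV hh hst (by omega) (by omega)

/-- The tail of the tail piece avoids the bottom level. [cite: DuminilCopinSmirnov2012, §3; lane (MATHS-NOTE-k1-renewal [A](3))] -/
theorem lev_ne_zero_of_mem_tail_tailP (hc : l.IsChain hvGraph.Adj) (hnd : l.Nodup) (hV : ∀ v ∈ l, v ∈ stripV T L)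
    {hl : l ≠ []} (hlast : lev (l.getLast hl) = 2 * (T : ℤ) - 1) (hst : sIdx l < tIdx l) {v : HV} (hv : v ∈ (tailP l).tail) :
    lev v ≠ 0 := by
  rw [tailP, List.tail_drop, List.mem_drop_iff_getElem] at hv
  obtain ⟨j, hj, rfl⟩ := hv
  exact lev_ne_zero_of_t1Idx_lt hc hnd hV hlast hst (by omega) (by omega)

/-- The `InLev` property of sublists of a list inside a strip domain. [cite: DuminilCopinSmirnov2012, §3] -/
theorem inLev_of_subset (hV : ∀ v ∈ l, v ∈ stripV T L) {l' : List HV} (h : l' ⊆ l) : InLev T l' :=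
  fun v hv => lev_bounds_of_mem_stripV (hV v (h hv))

/-- ★ The head piece is a top-free head of length `s + 1`. [cite: DuminilCopinSmirnov2012, §3; lane (MATHS-NOTE-k1-renewal [A](1))] -/
theorem headP_mem_topFreeN (hc : l.IsChain hvGraph.Adj) (hnd : l.Nodup) (hV : ∀ v ∈ l, v ∈ stripV T L)
    (hh : l.head? = some hvOrigin) (hst : sIdx l < tIdx l) {N : ℕ} (hN : l.length ≤ N + 1) : headP l ∈ topFreeN T N := by
  have hl : l ≠ [] := by rintro rfl; simp at hh
  obtain ⟨hs1, -, ht1l, -, -⟩ := t1Idx_spec hl hst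
  have hlen := (length_pieces hl hst).1
  rw [topFreeN, mem_filter, mem_biUnion]
  refine ⟨⟨sIdx l, mem_range.2 (by omega), ?_⟩, ?_, ?_⟩
  · rw [mem_stripChains_iff]
    refine ⟨hc.take _, hnd.sublist (List.take_sublist _ _), hlen, ⟨hvOrigin, ?_, rfl⟩,
      inLev_of_subset hV (List.take_sublist _ _).subset⟩
    rw [headP, List.head?_take, if_neg (by omega), hh]
  · rw [headP, List.head?_take, if_neg (by omega), hh]
  · rw [headP, List.dropLast_take (by omega), Nat.add_sub_cancel]
    exact topCnt_take_sIdx_eq_zero hc hnd hV hh hst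

/-- ★ The standardised middle piece is a horizontal bridge of the strip. [cite: DuminilCopinHammond2013, §2.2; lane (MATHS-NOTE-k1-renewal [A](2))] -/
theorem xstd_midP_mem_hBridgesN (hc : l.IsChain hvGraph.Adj) (hnd : l.Nodup) (hV : ∀ v ∈ l, v ∈ stripV T L)
    (hh : l.head? = some hvOrigin) (hst : sIdx l < tIdx l) {N : ℕ} (hN : l.length ≤ N + 1) :
    xstd (midP l) ∈ hBridgesN T N := by
  have hl : l ≠ [] := by rintro rfl; simp at hh
  obtain ⟨hs1, -, ht1l, -, -⟩ := t1Idx_spec hl hst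
  have hlen := (length_pieces hl hst).2.1
  have hsub : midP l ⊆ l := fun v hv => (List.take_sublist _ _).subset ((List.drop_sublist _ _).subset hv)
  have hsubl : (midP l).Sublist l := (List.drop_sublist _ _).trans (List.take_sublist _ _)
  rw [hBridgesN, mem_filter, mem_biUnion]
  refine ⟨⟨t1Idx l - sIdx l, mem_range.2 (by omega), ?_⟩, isHBridge_xstd (isHBridge_midP hl hst)⟩
  rw [mem_stripChains_iff]
  have hv := List.head?_eq_some_head (midP_ne_nil hl hst)
  set v := (midP l).head (midP_ne_nil hl hst)
  refine ⟨isChain_xstd ((hc.take _).drop _), nodup_xstd (hnd.sublist hsubl), by rw [length_xstd, hlen]; omega,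
    ⟨(0, v.2.1, v.2.2), head?_xstd hv, rfl⟩, inLev_xstd (inLev_of_subset hV hsub)⟩

/-- ★ The standardised tail piece is a bottom-free tail of the strip. [cite: DuminilCopinSmirnov2012, §3; lane (MATHS-NOTE-k1-renewal [A](3))] -/
theorem xstd_tailP_mem_botFreeN (hc : l.IsChain hvGraph.Adj) (hnd : l.Nodup) (hV : ∀ v ∈ l, v ∈ stripV T L)
    {hl : l ≠ []} (hlast : lev (l.getLast hl) = 2 * (T : ℤ) - 1) (hst : sIdx l < tIdx l)
    {N : ℕ} (hN : l.length ≤ N + 1) : xstd (tailP l) ∈ botFreeN T N := by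
  obtain ⟨hs1, -, ht1l, -, -⟩ := t1Idx_spec hl hst
  have hlen := (length_pieces hl hst).2.2
  have hne : tailP l ≠ [] := by rw [tailP, ne_eq, List.drop_eq_nil_iff]; omega
  have hsubl : (tailP l).Sublist l := List.drop_sublist _ _
  rw [botFreeN, mem_filter, mem_biUnion]
  refine ⟨⟨l.length - t1Idx l - 1, mem_range.2 (by omega), ?_⟩, ?_, ?_⟩
  · rw [mem_stripChains_iff]
    have hv : (tailP l).head? = some (l[t1Idx l]) := by rw [tailP, List.head?_drop, List.getElem?_eq_getElem ht1l]
    refine ⟨isChain_xstd (hc.drop _), nodup_xstd (hnd.sublist hsubl), by rw [length_xstd, hlen]; omega,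
      ⟨(0, (l[t1Idx l]).2.1, (l[t1Idx l]).2.2), head?_xstd hv, rfl⟩, inLev_xstd (inLev_of_subset hV hsubl.subset)⟩
  · intro v hv
    rw [xstd, ← List.map_tail, List.mem_map] at hv
    obtain ⟨w, hw, rfl⟩ := hv
    rw [lev_shift_zero]
    exact lev_ne_zero_of_mem_tail_tailP hc hnd hV hlast hst hw
  · have e1 : (tailP l).getLast? = some (l.getLast hl) := by
      rw [tailP, List.getLast?_drop, if_neg (by omega), List.getLast?_eq_some_getLast]
    rw [xstd, List.getLast?_map, e1, Option.map_some, Option.getD_some, lev_shift_zero, hlast]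

end Decomposition


/-! ### §7 The case-A sum bound: weights multiply, the decomposition is injective -/

section CaseA

variable {T L : ℕ} {l : List HV}

/-- The normalised decomposition triple of a list (plumbing). [folklore] -/
def decTriple (l : List HV) : List HV × List HV × List HV := (headP l, xstd (midP l), xstd (tailP l))

/-- The weight of a triple: `x_c^{|q|−1} · x_c^{|h|} y^{#top h} · x_c^{|r|−1} y^{#top r.tail}` (plumbing). [folklore] -/
def tripleWt (T : ℕ) (y : ℝ) (t : List HV × List HV × List HV) : ℝ :=
  hexCriticalFugacity ^ (t.1.length - 1) *
    (hexCriticalFugacity ^ t.2.1.length * y ^ topCnt T t.2.1) *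
    (hexCriticalFugacity ^ (t.2.2.length - 1) * y ^ topCnt T t.2.2.tail)

/-- Triple weights are non-negative for `y ≥ 0`. [cite: DuminilCopinHammond2013, §2.2 (bridge decomposition: bookkeeping of indices and pieces); lane plumbing] -/
theorem tripleWt_nonneg (T : ℕ) {y : ℝ} (hy : 0 ≤ y) (t : List HV × List HV × List HV) : 0 ≤ tripleWt T y t := by
  have hx := hexCriticalFugacity_pos_lt_one.1.le
  unfold tripleWt; positivity

/-- ★ **The weight of a case-A bridge list is the product of the weights of its three pieces.**
[cite: BeatonBousquetMelouDeGierDuminilCopinGuttmann2014, §4 (weights x_c^{|γ|} y^{#contacts}); lane (MATHS-NOTE-k1-renewal [A](4))] -/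
theorem wt_eq_tripleWt_decTriple (hc : l.IsChain hvGraph.Adj) (hnd : l.Nodup) (hV : ∀ v ∈ l, v ∈ stripV T L)
    (hh : l.head? = some hvOrigin) (hst : sIdx l < tIdx l) (y : ℝ) :
    hexCriticalFugacity ^ l.length * y ^ topCnt T l = tripleWt T y (decTriple l) := by
  have hl : l ≠ [] := by rintro rfl; simp at hh
  obtain ⟨hs1, -, ht1l, -, -⟩ := t1Idx_spec hl hst
  obtain ⟨hlen1, hlen2, hlen3⟩ := length_pieces hl hst
  have hdec := take_sIdx_append_midP_append hl hst
  have htop : topCnt T l = topCnt T (midP l) + topCnt T (tailP l).tail := by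
    conv_lhs => rw [← hdec]
    rw [topCnt_append, topCnt_append, topCnt_take_sIdx_eq_zero hc hnd hV hh hst, zero_add]
  have hlen : l.length = sIdx l + (midP l).length + ((tailP l).length - 1) := by
    have := congrArg List.length hdec
    rw [List.length_append, List.length_append, List.length_tail, List.length_take] at this
    omega
  simp only [tripleWt, decTriple, length_xstd, topCnt_xstd, hlen1, Nat.add_sub_cancel]
  rw [xstd, ← List.map_tail, topCnt_map_shift, htop, hlen, pow_add, pow_add, pow_add]
  ring

/-- ★ **The decomposition is injective** on case-A bridge lists. [lane (MATHS-NOTE-k1-renewal [A](4))] [cite: DuminilCopinHammond2013, §2.2 (a walk is the concatenation of its pieces)] -/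
theorem decTriple_injOn :
    Set.InjOn decTriple {l : List HV | l ≠ [] ∧ sIdx l < tIdx l} := by
  intro l hl l' hl' heq
  obtain ⟨hln, hst⟩ := hl
  obtain ⟨hln', hst'⟩ := hl'
  simp only [decTriple, Prod.mk.injEq] at heq
  obtain ⟨h1, h2, h3⟩ := heq
  obtain ⟨hs1, -, ht1l, -, -⟩ := t1Idx_spec hln hst
  obtain ⟨hs1', -, ht1l', -, -⟩ := t1Idx_spec hln' hst'
  -- the head pieces have lengths `s + 1`, `s' + 1`
  have hs : sIdx l = sIdx l' := by
    have := congrArg List.length h1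
    rw [(length_pieces hln hst).1, (length_pieces hln' hst').1] at this
    omega
  -- the middle pieces have the same head `l[s] = l'[s]`, hence are equal
  have hhead : (midP l).head? = (midP l').head? := by
    rw [List.head?_eq_some_head (midP_ne_nil hln hst), List.head?_eq_some_head (midP_ne_nil hln' hst'),
      head_midP hln, head_midP hln']
    congr 1
    have e1 : (headP l).getLast (by rw [headP]; simp [List.take_eq_nil_iff, hln]) = l[sIdx l]'(sIdx_spec hln).1 :=
      getLast_take_succ (sIdx_spec hln).1 _
    have e2 : (headP l').getLast (by rw [headP]; simp [List.take_eq_nil_iff, hln']) = l'[sIdx l']'(sIdx_spec hln').1 :=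
      getLast_take_succ (sIdx_spec hln').1 _
    rw [← e1, ← e2]
    congr 1
  have hmid : midP l = midP l' := xstd_inj_of_head h2 hhead
  have ht : t1Idx l = t1Idx l' := by
    have := congrArg List.length hmid
    rw [(length_pieces hln hst).2.1, (length_pieces hln' hst').2.1] at this
    omega
  -- hence `l[0 .. t₁] = l'[0 .. t₁]`
  have htake : l.take (t1Idx l + 1) = l'.take (t1Idx l' + 1) := by
    rw [← take_sIdx_append_midP hln hst, ← take_sIdx_append_midP hln' hst', hmid]
    congr 1
    have e1 : l.take (sIdx l) = (headP l).take (sIdx l) := by rw [headP, List.take_take, Nat.min_eq_left (by omega)]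
    have e2 : l'.take (sIdx l') = (headP l').take (sIdx l') := by rw [headP, List.take_take, Nat.min_eq_left (by omega)]
    rw [e1, e2, h1, hs]
  -- the tail pieces have the same head `l[t₁] = l'[t₁]`, hence are equal
  have hhead' : (tailP l).head? = (tailP l').head? := by
    rw [tailP, tailP, List.head?_drop, List.head?_drop, ← List.getElem?_take_of_lt (Nat.lt_succ_self _), htake, ht,
      List.getElem?_take_of_lt (Nat.lt_succ_self _)]
  have htail : tailP l = tailP l' := xstd_inj_of_head h3 hhead'
  calc l = l.take (t1Idx l + 1) ++ (tailP l).tail := by rw [tailP, List.tail_drop, List.take_append_drop]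
    _ = l'.take (t1Idx l' + 1) ++ (tailP l').tail := by rw [htake, htail]
    _ = l' := by rw [tailP, List.tail_drop, List.take_append_drop]

/-- The case-A bridge lists of `S_{T,L}` (plumbing). [folklore] -/
def caseA (T L : ℕ) : Finset (List HV) := (bridgeLists T L).filter fun l => sIdx l < tIdx l

/-- The case-B bridge lists of `S_{T,L}` (plumbing). [folklore] -/
def caseB (T L : ℕ) : Finset (List HV) := (bridgeLists T L).filter fun l => tIdx l < sIdx l

/-- Bridge lists have at least two vertices. [cite: DuminilCopinSmirnov2012, §3] -/
theorem two_le_length_of_mem_bridgeLists (hT : 1 ≤ T) (hl : l ∈ bridgeLists T L) : 2 ≤ l.length := by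
  obtain ⟨hc, hh, hnd, hV, hne, hlev⟩ := (mem_bridgeLists_iff hT).1 hl
  by_contra h2
  have h1 : l.length = 1 := by
    have := List.length_pos_of_ne_nil hne; omega
  obtain ⟨v, rfl⟩ := List.length_eq_one_iff.1 h1
  simp only [List.head?_cons, Option.some.injEq] at hh
  subst hh
  simp [hvOrigin] at hlev
  omega

/-- Bridge lists are bounded in length by the size of the domain. [cite: DuminilCopinSmirnov2012, §3] -/
theorem length_le_card_stripV (hT : 1 ≤ T) (hl : l ∈ bridgeLists T L) : l.length ≤ (stripV T L).card := by
  obtain ⟨-, -, hnd, hV, -⟩ := (mem_bridgeLists_iff hT).1 hl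
  rw [← List.toFinset_card_of_nodup hnd]
  exact Finset.card_le_card fun v hv => hV v (List.mem_toFinset.1 hv)

/-- ★ **The case-A sum is bounded by the product of the three class sums.**
[cite: BeatonBousquetMelouDeGierDuminilCopinGuttmann2014, §4; lane (MATHS-NOTE-k1-renewal [A](4))] -/
theorem sum_caseA_le (hT : 1 ≤ T) {y : ℝ} (hy : 0 ≤ y) {N : ℕ} (hN : (stripV T L).card ≤ N + 1) :
    ∑ l ∈ caseA T L, hexCriticalFugacity ^ l.length * y ^ topCnt T l ≤
      topFreeSumN T N * hBridgeSumN T N y * botFreeSumN T N y := by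
  classical
  have hmem : ∀ l ∈ caseA T L, l.IsChain hvGraph.Adj ∧ l.head? = some hvOrigin ∧ l.Nodup ∧ (∀ v ∈ l, v ∈ stripV T L) ∧
      (∃ h : l ≠ [], lev (l.getLast h) = 2 * (T : ℤ) - 1) ∧ sIdx l < tIdx l ∧ l.length ≤ N + 1 := by
    intro l hl
    rw [caseA, mem_filter] at hl
    obtain ⟨hc, hh, hnd, hV, hlast⟩ := (mem_bridgeLists_iff hT).1 hl.1
    exact ⟨hc, hh, hnd, hV, hlast, hl.2, (length_le_card_stripV hT hl.1).trans hN⟩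
  calc ∑ l ∈ caseA T L, hexCriticalFugacity ^ l.length * y ^ topCnt T l
      = ∑ l ∈ caseA T L, tripleWt T y (decTriple l) := by
        refine sum_congr rfl fun l hl => ?_
        obtain ⟨hc, hh, hnd, hV, -, hst, -⟩ := hmem l hl
        exact wt_eq_tripleWt_decTriple hc hnd hV hh hst y
    _ = ∑ t ∈ (caseA T L).image decTriple, tripleWt T y t := by
        rw [sum_image]
        intro l hl l' hl' h
        have h1 := hmem l hl; have h2 := hmem l' hl'
        exact decTriple_injOn ⟨by rintro rfl; simp at h1, h1.2.2.2.2.2.1⟩ ⟨by rintro rfl; simp at h2, h2.2.2.2.2.2.1⟩ h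
    _ ≤ ∑ t ∈ topFreeN T N ×ˢ (hBridgesN T N ×ˢ botFreeN T N), tripleWt T y t := by
        refine sum_le_sum_of_subset_of_nonneg (fun t ht => ?_) fun t _ _ => tripleWt_nonneg T hy t
        rw [mem_image] at ht
        obtain ⟨l, hl, rfl⟩ := ht
        obtain ⟨hc, hh, hnd, hV, ⟨hne, hlast⟩, hst, hlen⟩ := hmem l hl
        rw [decTriple, mem_product, mem_product]
        exact ⟨headP_mem_topFreeN hc hnd hV hh hst hlen, xstd_midP_mem_hBridgesN hc hnd hV hh hst hlen,
          xstd_tailP_mem_botFreeN hc hnd hV hlast hst hlen⟩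
    _ = ∑ q ∈ topFreeN T N, ∑ h ∈ hBridgesN T N, ∑ r ∈ botFreeN T N,
          hexCriticalFugacity ^ (q.length - 1) * ((hexCriticalFugacity ^ h.length * y ^ topCnt T h) *
            (hexCriticalFugacity ^ (r.length - 1) * y ^ topCnt T r.tail)) := by
        rw [sum_product]
        refine sum_congr rfl fun q _ => ?_
        rw [sum_product]
        refine sum_congr rfl fun h _ => sum_congr rfl fun r _ => ?_
        simp only [tripleWt]; ring
    _ = topFreeSumN T N * hBridgeSumN T N y * botFreeSumN T N y := by
        rw [topFreeSumN, hBridgeSumN, botFreeSumN, mul_assoc, sum_mul_sum (hBridgesN T N), sum_mul_sum]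
        refine sum_congr rfl fun q _ => sum_congr rfl fun h _ => ?_
        rw [mul_sum]

end CaseA


/-! ### §8 The mirror exchanges case A and case B -/

section Mirror

variable {T L : ℕ} {l : List HV}

/-- `topCnt` is invariant under a level-preserving map. [cite: BeatonBousquetMelouDeGierDuminilCopinGuttmann2014, §3.2 (tc(ω) = contacts with the top)] -/
theorem topCnt_map_mirrorX (T : ℕ) (l : List HV) : topCnt T (l.map mirrorX) = topCnt T l := by
  induction l with
  | nil => rfl
  | cons v l ih => rw [List.map_cons, topCnt_cons, topCnt_cons, ih, lev_mirrorX]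

/-- The mirror of a bridge list is a bridge list. [cite: DuminilCopinSmirnov2012, §3 (Fig. 3: S_{T,L} is symmetric)] -/
theorem map_mirrorX_mem_bridgeLists (hT : 1 ≤ T) (hl : l ∈ bridgeLists T L) : l.map mirrorX ∈ bridgeLists T L := by
  obtain ⟨hc, hh, hnd, hV, hne, hlev⟩ := (mem_bridgeLists_iff hT).1 hl
  rw [mem_bridgeLists_iff hT]
  have hc' : (l.map mirrorX).IsChain hvGraph.Adj := by
    rw [List.isChain_map]; exact hc.imp fun x y hxy => mirrorX.map_rel_iff.2 hxy
  refine ⟨hc', by rw [List.head?_map, hh, Option.map_some, mirrorX_hvOrigin], hnd.map mirrorX.injective, fun x hx => ?_,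
    by simpa using hne, ?_⟩
  · rw [List.mem_map] at hx
    obtain ⟨w, hw, rfl⟩ := hx
    exact mirrorX_mem_stripV (hV w hw)
  · rw [List.getLast_map, lev_mirrorX]; exact hlev

/-- Columns of the mirrored list. [cite: DuminilCopinHammond2013, §2.2 (bridge decomposition: bookkeeping of indices and pieces); lane plumbing] -/
theorem xiAt_map_mirrorX (l : List HV) (j : ℕ) : xiAt (l.map mirrorX) j = -xiAt l j := by
  unfold xiAt
  by_cases hj : j < l.length
  · rw [List.getD_eq_getElem _ _ (by simpa using hj), List.getD_eq_getElem _ _ hj, List.getElem_map, xi_mirrorX]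
  · rw [List.getD_eq_default _ _ (by simpa using not_lt.1 hj), List.getD_eq_default _ _ (not_lt.1 hj), xi_hvOrigin, neg_zero]

/-- The argmin set of the mirrored list is the argmax set. [cite: DuminilCopinHammond2013, §2.2 (bridge decomposition: bookkeeping of indices and pieces); lane plumbing] -/
theorem minIdxs_map_mirrorX (l : List HV) : minIdxs (l.map mirrorX) = maxIdxs l := by
  ext j
  simp only [minIdxs, maxIdxs, mem_filter, List.length_map, xiAt_map_mirrorX, neg_le_neg_iff]

/-- The argmax set of the mirrored list is the argmin set. [cite: DuminilCopinHammond2013, §2.2 (bridge decomposition: bookkeeping of indices and pieces); lane plumbing] -/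
theorem maxIdxs_map_mirrorX (l : List HV) : maxIdxs (l.map mirrorX) = minIdxs l := by
  ext j
  simp only [minIdxs, maxIdxs, mem_filter, List.length_map, xiAt_map_mirrorX, neg_le_neg_iff]

/-- The last leftmost index of the mirrored list is the last rightmost index. [cite: DuminilCopinHammond2013, §2.2 (bridge decomposition: bookkeeping of indices and pieces); lane plumbing] -/
theorem sIdx_map_mirrorX (l : List HV) : sIdx (l.map mirrorX) = tIdx l := by
  simp only [sIdx, tIdx, minIdxs_map_mirrorX]

/-- The last rightmost index of the mirrored list is the last leftmost index. [cite: DuminilCopinHammond2013, §2.2 (bridge decomposition: bookkeeping of indices and pieces); lane plumbing] -/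
theorem tIdx_map_mirrorX (l : List HV) : tIdx (l.map mirrorX) = sIdx l := by
  simp only [sIdx, tIdx, maxIdxs_map_mirrorX]

/-- ★ **Case B weighs at most as much as case A** (the mirror maps case B injectively into case A, preserving weights).
[cite: DuminilCopinSmirnov2012, §3 (Fig. 3: the symmetry of S_{T,L}); lane (MATHS-NOTE-k1-renewal [A])] -/
theorem sum_caseB_le_sum_caseA (hT : 1 ≤ T) {y : ℝ} (hy : 0 ≤ y) :
    ∑ l ∈ caseB T L, hexCriticalFugacity ^ l.length * y ^ topCnt T l ≤
      ∑ l ∈ caseA T L, hexCriticalFugacity ^ l.length * y ^ topCnt T l := by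
  classical
  have hinj : Set.InjOn (fun l : List HV => l.map mirrorX) (caseB T L : Set (List HV)) :=
    fun l _ l' _ h => (List.map_injective_iff.2 mirrorX.injective) h
  calc ∑ l ∈ caseB T L, hexCriticalFugacity ^ l.length * y ^ topCnt T l
      = ∑ l ∈ caseB T L, hexCriticalFugacity ^ (l.map mirrorX).length * y ^ topCnt T (l.map mirrorX) := by
        simp only [List.length_map, topCnt_map_mirrorX]
    _ = ∑ l ∈ (caseB T L).image fun l => l.map mirrorX, hexCriticalFugacity ^ l.length * y ^ topCnt T l := by
        rw [sum_image hinj]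
    _ ≤ ∑ l ∈ caseA T L, hexCriticalFugacity ^ l.length * y ^ topCnt T l := by
        refine sum_le_sum_of_subset_of_nonneg (fun l' hl' => ?_) fun _ _ _ =>
          mul_nonneg (pow_nonneg hexCriticalFugacity_pos_lt_one.1.le _) (pow_nonneg hy _)
        rw [mem_image] at hl'
        obtain ⟨l, hl, rfl⟩ := hl'
        rw [caseB, mem_filter] at hl
        rw [caseA, mem_filter, sIdx_map_mirrorX, tIdx_map_mirrorX]
        exact ⟨map_mirrorX_mem_bridgeLists hT hl.1, hl.2⟩

/-- Every bridge list is in case A or in case B. [cite: DuminilCopinSmirnov2012, §3] -/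
theorem bridgeLists_eq_caseA_union_caseB (hT : 1 ≤ T) :
    bridgeLists T L = caseA T L ∪ caseB T L := by
  ext l
  rw [mem_union, caseA, caseB, mem_filter, mem_filter]
  constructor
  · intro hl
    obtain ⟨hc, hh, hnd, hV, -⟩ := (mem_bridgeLists_iff hT).1 hl
    have hne := sIdx_ne_tIdx hc hh hV (two_le_length_of_mem_bridgeLists hT hl)
    rcases lt_or_gt_of_ne hne with h | h
    · exact Or.inl ⟨hl, h⟩
    · exact Or.inr ⟨hl, h⟩
  · rintro (⟨h, -⟩ | ⟨h, -⟩) <;> exact h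

/-- ★ **`B_{T,L}(x_c; y) ≤ 2 · F₁ · D · F₃`** (truncation `N + 1 ≥ |V(S_{T,L})|`). [cite: BeatonBousquetMelouDeGierDuminilCopinGuttmann2014, §4 (B_{T,L}(x,y)); lane (MATHS-NOTE-k1-renewal [A])] -/
theorem stripGFy_beta_le_two_mul (hT : 1 ≤ T) {y : ℝ} (hy : 0 ≤ y) {N : ℕ} (hN : (stripV T L).card ≤ N + 1) :
    stripGFy T L (IsBetaDart T) y ≤ 2 * (topFreeSumN T N * hBridgeSumN T N y * botFreeSumN T N y) := by
  classical
  rw [stripGFy_beta_eq_sum_bridgeLists hT, bridgeLists_eq_caseA_union_caseB hT]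
  have hdisj : Disjoint (caseA T L) (caseB T L) := by
    rw [caseA, caseB, disjoint_filter]; intro l _ h1 h2; omega
  rw [sum_union hdisj]
  have hA := sum_caseA_le hT hy hN (L := L)
  have hB := sum_caseB_le_sum_caseA hT hy (L := L)
  change ∑ l ∈ caseA T L, hexCriticalFugacity ^ l.length * y ^ topCnt T l +
    ∑ l ∈ caseB T L, hexCriticalFugacity ^ l.length * y ^ topCnt T l ≤ _
  linarith

end Mirror


/-! ### §9 Finiteness of the end classes (a walk avoiding one wall lives in width `T − 1`) -/

section Finiteness

open Filter Topology

variable {T : ℕ}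

/-- **Bounded partial sums of the subcritical strip series**: if `x_c ν_T(y) < 1` (`y > 0`) there is `C` with
`Σ_{n<M} x_c^n Z_{T,n}(y) ≤ C` for all `M`. [cite: BeatonBousquetMelouDeGierDuminilCopinGuttmann2014, proof of Corollary 8 (arXiv v5 p. 13: "the series C_T(x_c,y) converges if x_c < ρ_T(y)")] -/
theorem exists_partialSum_stripZL_le (hT : 1 ≤ T) {y : ℝ} (hy : 0 < y) (hν : hexCriticalFugacity * stripNu T y < 1) :
    ∃ C : ℝ, ∀ M : ℕ, ∑ n ∈ range M, hexCriticalFugacity ^ n * stripZL T n y ≤ C := by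
  have hx := hexCriticalFugacity_pos_lt_one.1
  set θ : ℝ := (hexCriticalFugacity * stripNu T y + 1) / 2 with hθ
  have hθ1 : θ < 1 := by rw [hθ]; linarith
  have hθν : hexCriticalFugacity * stripNu T y < θ := by rw [hθ]; linarith
  have hθ0 : 0 < θ := lt_trans (mul_pos hx (stripNu_pos hT hy)) hθν
  set ρ := θ / hexCriticalFugacity with hρ
  have hνρ : stripNu T y < ρ := by rw [hρ, lt_div_iff₀ hx, mul_comm]; exact hθν
  have hρx : hexCriticalFugacity * ρ = θ := by rw [hρ]; field_simp
  have h1 := (tendsto_stripZL_rpow hT hy).eventually (gt_mem_nhds hνρ)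
  obtain ⟨n₀, hn₀⟩ := eventually_atTop.1 (h1.and (eventually_ge_atTop 1))
  have hpt : ∀ n, n₀ ≤ n → hexCriticalFugacity ^ n * stripZL T n y ≤ θ ^ n := by
    intro n hn
    obtain ⟨hlt, hn1⟩ := hn₀ n hn
    have hZ0 : 0 ≤ stripZL T n y := stripZL_nonneg T n hy.le
    have hpow : stripZL T n y ≤ ρ ^ n := by
      have h2 : ((stripZL T n y) ^ (1 / (n : ℝ))) ^ (n : ℝ) ≤ ρ ^ (n : ℝ) :=
        Real.rpow_le_rpow (Real.rpow_nonneg hZ0 _) hlt.le (Nat.cast_nonneg n)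
      rw [← Real.rpow_mul hZ0, one_div_mul_cancel (by positivity), Real.rpow_one, Real.rpow_natCast] at h2
      exact h2
    calc hexCriticalFugacity ^ n * stripZL T n y ≤ hexCriticalFugacity ^ n * ρ ^ n :=
          mul_le_mul_of_nonneg_left hpow (pow_nonneg hx.le n)
      _ = θ ^ n := by rw [← mul_pow, hρx]
  set f : ℕ → ℝ := fun n => hexCriticalFugacity ^ n * stripZL T n y with hf
  have hf0 : ∀ n, 0 ≤ f n := fun n => mul_nonneg (pow_nonneg hx.le _) (stripZL_nonneg T n hy.le)
  refine ⟨∑ n ∈ range n₀, f n + 1 / (1 - θ), fun M => ?_⟩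
  have hsplit : ∀ n, f n ≤ (if n < n₀ then f n else 0) + (if n₀ ≤ n then θ ^ n else 0) := by
    intro n
    by_cases h : n < n₀
    · rw [if_pos h, if_neg (by omega)]; simp
    · rw [if_neg h, if_pos (by omega), zero_add]; exact hpt n (by omega)
  calc ∑ n ∈ range M, f n ≤ ∑ n ∈ range M, ((if n < n₀ then f n else 0) + (if n₀ ≤ n then θ ^ n else 0)) :=
        sum_le_sum fun n _ => hsplit n
    _ = ∑ n ∈ range M, (if n < n₀ then f n else 0) + ∑ n ∈ range M, (if n₀ ≤ n then θ ^ n else 0) := sum_add_distrib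
    _ ≤ ∑ n ∈ range n₀, f n + 1 / (1 - θ) := by
        gcongr
        · calc ∑ n ∈ range M, (if n < n₀ then f n else 0)
              = ∑ n ∈ (range M).filter (· < n₀), f n := by rw [sum_filter]
            _ ≤ ∑ n ∈ range n₀, f n :=
                sum_le_sum_of_subset_of_nonneg (fun n hn => by simp only [mem_filter, mem_range] at hn ⊢; exact hn.2)
                  fun n _ _ => hf0 n
        · calc ∑ n ∈ range M, (if n₀ ≤ n then θ ^ n else 0) ≤ ∑ n ∈ range M, θ ^ n :=
                sum_le_sum fun n _ => by split_ifs; exacts [le_rfl, pow_nonneg hθ0.le n]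
            _ ≤ ∑' n, θ ^ n := (summable_geometric_of_lt_one hθ0.le hθ1).sum_le_tsum _ fun n _ => pow_nonneg hθ0.le n
            _ = 1 / (1 - θ) := by rw [tsum_geometric_of_lt_one hθ0.le hθ1, one_div]

/-- `Z_{T,n}(1)` is the number of `n`-step chains of the strip. [cite: BeatonBousquetMelouDeGierDuminilCopinGuttmann2014, §3.2 (c_{T,n} at unit fugacity)] -/
theorem stripZL_one_eq_card (T n : ℕ) : stripZL T n 1 = (stripChains T n).card := by
  simp [stripZL]

/-- ★ **The top-free heads have bounded total weight**: `F₁ := Σ x_c^{|q|−1} ≤ C₁` uniformly in the truncation.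
[cite: BeatonBousquetMelouDeGierDuminilCopinGuttmann2014, Corollary 8 (the strip series converge below y_T; here at y = 1 < y_T); lane (MATHS-NOTE-k1-renewal [F])] -/
theorem exists_topFreeSumN_le (hT : 1 ≤ T) : ∃ C : ℝ, ∀ N, topFreeSumN T N ≤ C := by
  classical
  have hν : hexCriticalFugacity * stripNu T 1 < 1 := by
    have h := (stripNu_lt_inv_iff hT one_pos).2 (one_lt_stripYT hT)
    have hx := hexCriticalFugacity_pos_lt_one.1
    calc hexCriticalFugacity * stripNu T 1 < hexCriticalFugacity * hexCriticalFugacity⁻¹ :=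
          mul_lt_mul_of_pos_left h hx
      _ = 1 := mul_inv_cancel₀ hx.ne'
  obtain ⟨C, hC⟩ := exists_partialSum_stripZL_le hT one_pos hν
  refine ⟨C, fun N => ?_⟩
  have hx := hexCriticalFugacity_pos_lt_one.1
  calc topFreeSumN T N ≤ ∑ l ∈ (Finset.range (N + 1)).biUnion fun n => stripChains T n, hexCriticalFugacity ^ (l.length - 1) :=
        sum_le_sum_of_subset_of_nonneg (filter_subset _ _) fun _ _ _ => pow_nonneg hx.le _
    _ = ∑ n ∈ range (N + 1), ∑ l ∈ stripChains T n, hexCriticalFugacity ^ (l.length - 1) :=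
        sum_biUnion (LinLow.disj_stripChains T _)
    _ = ∑ n ∈ range (N + 1), hexCriticalFugacity ^ n * stripZL T n 1 := by
        refine sum_congr rfl fun n _ => ?_
        rw [stripZL, mul_sum]
        refine sum_congr rfl fun l hl => ?_
        rw [(mem_stripChains_iff.1 hl).2.2.1, Nat.add_sub_cancel, one_pow, mul_one]
    _ ≤ C := hC _

/-- The down-shifted, standardised tail `l[2 ..]` of a list (plumbing). [folklore] -/
def downTail (l : List HV) : List HV := xstd ((l.drop 2).map (shift 0 (-1)))

/-- In a chain `b :: rest` avoiding the bottom level, ending on the top level `2T − 1 ≥ 3` and without repeated vertices,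
every vertex of `rest` has level at least `2` (a level-one vertex has a single neighbour off the bottom). [cite: DuminilCopinSmirnov2012, §3; lane (MATHS-NOTE-k1-renewal [F])] -/
theorem two_le_lev_aux (hT : 2 ≤ T) :
    ∀ (rest : List HV) (b : HV), (b :: rest).IsChain hvGraph.Adj → (b :: rest).Nodup → (∀ v ∈ b :: rest, lev v ≠ 0) →
      (∀ v ∈ rest, 0 ≤ lev v) → lev ((b :: rest).getLast (List.cons_ne_nil b rest)) = 2 * (T : ℤ) - 1 →
      ∀ v ∈ rest, 2 ≤ lev v := by
  intro rest
  induction rest with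
  | nil => intro b _ _ _ _ _ v hv; simp at hv
  | cons c rest ih =>
    intro b hch hnd h0 hge hlast v hv
    have hbc : hvGraph.Adj b c := (List.isChain_cons_cons.1 hch).1
    have hch' : (c :: rest).IsChain hvGraph.Adj := (List.isChain_cons_cons.1 hch).2
    have hc2 : 2 ≤ lev c := by
      by_contra hlt
      have hc1 : lev c = 1 := by
        have := h0 c (by simp); have := hge c (by simp); omega
      cases rest with
      | nil =>
        simp only [List.getLast_cons_cons, List.getLast_singleton] at hlast
        omega
      | cons d rest' =>
        have hcd : hvGraph.Adj c d := (List.isChain_cons_cons.1 hch').1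
        have hb : b = (c.1, 1, false) := LinLow.eq_up_of_lev_one hc1 hbc.symm (h0 b (by simp))
        have hd : d = (c.1, 1, false) := LinLow.eq_up_of_lev_one hc1 hcd (h0 d (by simp))
        have : b ≠ d := by
          intro hbd
          have := (List.nodup_cons.1 hnd).1
          exact this (by rw [hbd]; simp)
        exact this (hb.trans hd.symm)
    rcases List.mem_cons.1 hv with rfl | hv'
    · exact hc2
    · refine ih c hch' (List.nodup_cons.1 hnd).2 (fun w hw => h0 w (List.mem_cons_of_mem b hw))
        (fun w hw => hge w (List.mem_cons_of_mem c hw)) ?_ v hv'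
      rw [List.getLast_cons (List.cons_ne_nil c rest)] at hlast
      exact hlast

/-- In a bottom-free tail of width `T ≥ 2`, every vertex from the third on has level at least `2`.
[cite: DuminilCopinSmirnov2012, §3; lane (MATHS-NOTE-k1-renewal [F])] -/
theorem two_le_lev_of_mem_drop_two (hT : 2 ≤ T) {N : ℕ} {l : List HV} (hl : l ∈ botFreeN T N) {v : HV} (hv : v ∈ l.drop 2) :
    2 ≤ lev v := by
  rw [botFreeN, mem_filter, mem_biUnion] at hl
  obtain ⟨⟨n, -, hsc⟩, hbot, hlast⟩ := hl
  obtain ⟨hc, hnd, -, -, hin⟩ := mem_stripChains_iff.1 hsc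
  match l, hv with
  | a :: b :: rest, hv =>
    simp only [List.drop_succ_cons, List.drop_zero] at hv
    have hne : (a :: b :: rest) ≠ [] := List.cons_ne_nil _ _
    rw [List.getLast?_eq_some_getLast hne, Option.getD_some, List.getLast_cons (List.cons_ne_nil b rest)] at hlast
    exact two_le_lev_aux hT rest b (List.isChain_cons_cons.1 hc).2 (List.nodup_cons.1 hnd).2
      (fun w hw => hbot w (by simpa using hw)) (fun w hw => (hin w (by simp [hw])).1) hlast v hv


/-- The truncated three-vertex prefix and the down-shifted tail of a list (plumbing). [folklore] -/
def botSplit (l : List HV) : List HV × List HV := (l.take 3, downTail l)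

/-- Weight used for the bottom-free comparison (plumbing). [folklore] -/
def botWt (T : ℕ) (y : ℝ) (pm : List HV × List HV) : ℝ :=
  hexCriticalFugacity ^ 2 * y * (hexCriticalFugacity ^ (pm.2.length - 1) * y ^ topCnt (T - 1) pm.2)

set_option maxHeartbeats 400000 in
/-- ★ **The bottom-free tails have bounded total weight** when the width-`(T−1)` strip is subcritical at `y`
(`x_c ν_{T−1}(y) < 1`, `y ≥ 1`, `T ≥ 2`): `F₃(y) ≤ C₃` uniformly in the truncation.  A bottom-free tail has its vertices from the
third on in the levels `2 … 2T−1`, i.e. (shifted down one level pair) in the strip of width `T − 1`.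
[cite: BeatonBousquetMelouDeGierDuminilCopinGuttmann2014, Corollary 8 (strip series converge below the threshold) and (15) (y_{T} decreases in T); lane (MATHS-NOTE-k1-renewal [F])] -/
theorem exists_botFreeSumN_le (hT : 2 ≤ T) {y : ℝ} (hy1 : 1 ≤ y) (hν : hexCriticalFugacity * stripNu (T - 1) y < 1) :
    ∃ C : ℝ, ∀ N, botFreeSumN T N y ≤ C := by
  classical
  have hx := hexCriticalFugacity_pos_lt_one
  have hy0 : 0 < y := by linarith
  have hT1 : 1 ≤ T - 1 := by omega
  obtain ⟨C', hC'⟩ := exists_partialSum_stripZL_le hT1 hy0 hν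
  have hC'0 : 0 ≤ C' := le_trans (by simp) (hC' 0)
  set K₀ : ℝ := ((stripChains T 0).card + (stripChains T 1).card : ℕ) * y with hK₀
  set K₁ : ℝ := (stripChains T 2).card * (hexCriticalFugacity ^ 2 * y * C') with hK₁
  refine ⟨K₁ + K₀, fun N => ?_⟩
  -- split by length
  set S := botFreeN T N with hS
  rw [botFreeSumN, ← hS, ← sum_filter_add_sum_filter_not S (fun l => 3 ≤ l.length)]
  refine add_le_add ?_ ?_
  · ------------------------------------------------------------------ long lists (≥ 3 vertices)
    have hmemS : ∀ l ∈ S.filter (fun l => 3 ≤ l.length), ∃ n, l ∈ stripChains T n ∧ l.IsChain hvGraph.Adj ∧ l.Nodup ∧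
        l.length = n + 1 ∧ (∃ v, l.head? = some v ∧ v.1 = 0) ∧ InLev T l ∧ 3 ≤ l.length ∧ l ∈ botFreeN T N := by
      intro l hl
      rw [mem_filter] at hl
      have hl' := hl.1
      rw [hS, botFreeN, mem_filter, mem_biUnion] at hl'
      obtain ⟨⟨n, -, hsc⟩, -, -⟩ := hl'
      obtain ⟨hc, hnd, hlen, hh, hin⟩ := mem_stripChains_iff.1 hsc
      exact ⟨n, hsc, hc, hnd, hlen, hh, hin, hl.2, hS ▸ hl.1⟩
    -- (i) termwise comparison
    have hle : ∀ l ∈ S.filter (fun l => 3 ≤ l.length),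
        hexCriticalFugacity ^ (l.length - 1) * y ^ topCnt T l.tail ≤ botWt T y (botSplit l) := by
      intro l hl
      obtain ⟨n, -, hc, hnd, hlen, -, -, h3, hbf⟩ := hmemS l hl
      have hlenD : (downTail l).length = l.length - 2 := by rw [downTail, length_xstd, List.length_map, List.length_drop]
      have htopD : topCnt (T - 1) (downTail l) = topCnt T (l.drop 2) := by
        rw [downTail, topCnt_xstd, LinLow.topCnt_shift_down (by omega)]
      obtain ⟨a, b, rest, rfl⟩ : ∃ a b rest, l = a :: b :: rest := by
        match l, h3 with
        | a :: b :: rest, _ => exact ⟨a, b, rest, rfl⟩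
      have htail : topCnt T (b :: rest) ≤ 1 + topCnt T rest := by
        rw [topCnt_cons]
        split_ifs <;> omega
      simp only [List.drop_succ_cons, List.drop_zero] at htopD
      rw [botWt, botSplit]
      simp only [hlenD, htopD, List.length_cons, List.tail_cons]
      have hrest : 1 ≤ rest.length := by simp at h3; omega
      have e1 : rest.length + 1 + 1 - 1 = 2 + (rest.length - 1) := by omega
      have e2 : rest.length + 1 + 1 - 2 - 1 = rest.length - 1 := by omega
      rw [e1, e2, pow_add]
      calc hexCriticalFugacity ^ 2 * hexCriticalFugacity ^ (rest.length - 1) * y ^ topCnt T (b :: rest)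
          ≤ hexCriticalFugacity ^ 2 * hexCriticalFugacity ^ (rest.length - 1) * y ^ (1 + topCnt T rest) :=
            mul_le_mul_of_nonneg_left (pow_le_pow_right₀ hy1 htail) (mul_nonneg (pow_nonneg hx.1.le _) (pow_nonneg hx.1.le _))
        _ = hexCriticalFugacity ^ 2 * y * (hexCriticalFugacity ^ (rest.length - 1) * y ^ topCnt T rest) := by
            rw [pow_add, pow_one]; ring
    -- (ii) the image lies in `stripChains T 2 × ⋃_k stripChains (T−1) k`
    set U := (Finset.range (N + 1)).biUnion fun k => stripChains (T - 1) k with hU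
    have himg : ∀ l ∈ S.filter (fun l => 3 ≤ l.length), botSplit l ∈ stripChains T 2 ×ˢ U := by
      intro l hl
      obtain ⟨n, hsc, hc, hnd, hlen, ⟨v, hv, hv0⟩, hin, h3, hbf⟩ := hmemS l hl
      have hnN : n ≤ N := by
        have h' : l ∈ botFreeN T N := hbf
        rw [botFreeN, mem_filter, mem_biUnion] at h'
        obtain ⟨⟨n', hn', hsc'⟩, -⟩ := h'
        have := (mem_stripChains_iff.1 hsc').2.2.1
        rw [mem_range] at hn'; omega
      rw [botSplit, mem_product]
      constructor
      · rw [mem_stripChains_iff]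
        refine ⟨hc.take 3, hnd.sublist (List.take_sublist _ _), by rw [List.length_take]; omega, ⟨v, ?_, hv0⟩,
          fun w hw => hin w ((List.take_sublist _ _).subset hw)⟩
        rw [List.head?_take, if_neg (by norm_num), hv]
      · rw [hU, mem_biUnion]
        refine ⟨l.length - 3, mem_range.2 (by omega), ?_⟩
        rw [mem_stripChains_iff]
        have hne : (l.drop 2).map (shift 0 (-1)) ≠ [] := by simp [List.drop_eq_nil_iff]; omega
        have hcD : ((l.drop 2).map (shift 0 (-1))).IsChain hvGraph.Adj := by
          rw [List.isChain_map]; exact (hc.drop 2).imp fun a b hab => (shift _ _).map_rel_iff.2 hab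
        have hw := List.head?_eq_some_head hne
        set w := ((l.drop 2).map (shift 0 (-1))).head hne
        refine ⟨isChain_xstd hcD, nodup_xstd ((hnd.sublist (List.drop_sublist _ _)).map (shift _ _).injective),
          by rw [downTail, length_xstd, List.length_map, List.length_drop]; omega, ⟨(0, w.2.1, w.2.2), head?_xstd hw, rfl⟩,
          inLev_xstd fun u hu => ?_⟩
        rw [List.mem_map] at hu
        obtain ⟨u', hu', rfl⟩ := hu
        have h2 := two_le_lev_of_mem_drop_two hT hbf hu'
        have hup := (hin u' ((List.drop_sublist _ _).subset hu')).2
        rw [LinLow.lev_shift_down]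
        have hc' : ((T - 1 : ℕ) : ℤ) = (T : ℤ) - 1 := by push_cast [Nat.cast_sub (show 1 ≤ T by omega)]; ring
        rw [hc']
        constructor <;> omega
    -- (iii) injectivity
    have hinj : Set.InjOn botSplit (S.filter (fun l => 3 ≤ l.length) : Set (List HV)) := by
      intro l hl l' hl' heq
      obtain ⟨-, -, -, -, -, -, -, h3, -⟩ := hmemS l hl
      obtain ⟨-, -, -, -, -, -, -, h3', -⟩ := hmemS l' hl'
      simp only [botSplit, Prod.mk.injEq] at heq
      obtain ⟨htk, hdt⟩ := heq
      have h2' : l[2]? = l'[2]? := by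
        have := congrArg (fun t : List HV => t[2]?) htk
        simpa [List.getElem?_take] using this
      have h2 : l[2]'(by omega) = l'[2]'(by omega) := by
        rw [List.getElem?_eq_getElem (show 2 < l.length by omega), List.getElem?_eq_getElem (show 2 < l'.length by omega),
          Option.some.injEq] at h2'
        exact h2'
      have hhead : ((l.drop 2).map (shift 0 (-1))).head? = ((l'.drop 2).map (shift 0 (-1))).head? := by
        rw [List.head?_map, List.head?_map, List.head?_drop, List.head?_drop, List.getElem?_eq_getElem (by omega),
          List.getElem?_eq_getElem (by omega), h2]
      have hL : (l.drop 2).map (shift 0 (-1)) = (l'.drop 2).map (shift 0 (-1)) := xstd_inj_of_head hdt hhead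
      have hdrop : l.drop 2 = l'.drop 2 := (List.map_injective_iff.2 (shift _ _).injective) hL
      have htake : l.take 2 = l'.take 2 := by
        have := congrArg (fun t : List HV => t.take 2) htk
        simpa [List.take_take] using this
      rw [← List.take_append_drop 2 l, ← List.take_append_drop 2 l', htake, hdrop]
    -- (iv) sum over the product
    calc ∑ l ∈ S.filter (fun l => 3 ≤ l.length), hexCriticalFugacity ^ (l.length - 1) * y ^ topCnt T l.tail
        ≤ ∑ l ∈ S.filter (fun l => 3 ≤ l.length), botWt T y (botSplit l) := sum_le_sum hle
      _ = ∑ pm ∈ (S.filter (fun l => 3 ≤ l.length)).image botSplit, botWt T y pm := (sum_image hinj).symm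
      _ ≤ ∑ pm ∈ stripChains T 2 ×ˢ U, botWt T y pm := by
          refine sum_le_sum_of_subset_of_nonneg (fun pm hpm => ?_) fun pm _ _ =>
            mul_nonneg (mul_nonneg (pow_nonneg hx.1.le 2) hy0.le) (mul_nonneg (pow_nonneg hx.1.le _) (pow_nonneg hy0.le _))
          rw [mem_image] at hpm
          obtain ⟨l, hl, rfl⟩ := hpm
          exact himg l hl
      _ = (stripChains T 2).card * (hexCriticalFugacity ^ 2 * y *
            ∑ m ∈ U, hexCriticalFugacity ^ (m.length - 1) * y ^ topCnt (T - 1) m) := by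
          rw [sum_product]
          have hconst : ∀ x ∈ stripChains T 2, ∑ m ∈ U, botWt T y (x, m) =
              hexCriticalFugacity ^ 2 * y * ∑ m ∈ U, hexCriticalFugacity ^ (m.length - 1) * y ^ topCnt (T - 1) m :=
            fun x _ => by rw [mul_sum]; rfl
          rw [sum_congr rfl hconst, sum_const, nsmul_eq_mul]
      _ ≤ K₁ := by
          rw [hK₁]
          refine mul_le_mul_of_nonneg_left (mul_le_mul_of_nonneg_left ?_ (by positivity)) (Nat.cast_nonneg _)
          rw [hU, sum_biUnion (LinLow.disj_stripChains (T - 1) _)]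
          calc ∑ k ∈ range (N + 1), ∑ m ∈ stripChains (T - 1) k, hexCriticalFugacity ^ (m.length - 1) * y ^ topCnt (T - 1) m
              = ∑ k ∈ range (N + 1), hexCriticalFugacity ^ k * stripZL (T - 1) k y := by
                refine sum_congr rfl fun k _ => ?_
                rw [stripZL, mul_sum]
                refine sum_congr rfl fun m hm => ?_
                rw [(mem_stripChains_iff.1 hm).2.2.1, Nat.add_sub_cancel]
            _ ≤ C' := hC' _
  · ------------------------------------------------------------------ short lists (≤ 2 vertices)
    calc ∑ l ∈ S.filter (fun l => ¬ 3 ≤ l.length), hexCriticalFugacity ^ (l.length - 1) * y ^ topCnt T l.tail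
        ≤ ∑ l ∈ S.filter (fun l => ¬ 3 ≤ l.length), y := by
          refine sum_le_sum fun l hl => ?_
          rw [mem_filter] at hl
          have hlt : topCnt T l.tail ≤ 1 := (topCnt_le_length T _).trans (by rw [List.length_tail]; omega)
          calc hexCriticalFugacity ^ (l.length - 1) * y ^ topCnt T l.tail ≤ 1 * y ^ 1 :=
                mul_le_mul (pow_le_one₀ hx.1.le hx.2.le) (pow_le_pow_right₀ hy1 hlt) (by positivity) zero_le_one
            _ = y := by rw [one_mul, pow_one]
      _ = ((S.filter fun l => ¬ 3 ≤ l.length).card : ℝ) * y := by rw [sum_const, nsmul_eq_mul]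
      _ ≤ K₀ := by
          rw [hK₀]
          refine mul_le_mul_of_nonneg_right ?_ hy0.le
          have hsub : S.filter (fun l => ¬ 3 ≤ l.length) ⊆ stripChains T 0 ∪ stripChains T 1 := by
            intro l hl
            rw [mem_filter, hS, botFreeN, mem_filter, mem_biUnion] at hl
            obtain ⟨⟨⟨n, -, hsc⟩, -, -⟩, hlen3⟩ := hl
            have hlen := (mem_stripChains_iff.1 hsc).2.2.1
            rw [mem_union]
            rcases Nat.lt_or_ge n 1 with h | h
            · left
              have hn0 : n = 0 := by omega
              subst hn0; exact hsc
            · right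
              have hn1 : n = 1 := by omega
              subst hn1; exact hsc
          exact_mod_cast (card_le_card hsub).trans (card_union_le _ _)

end Finiteness


/-! ### §10 Assembly: the first-order bound of `B_T(x_c; ·)` at `y_T`, reduced to the horizontal bridges -/

section Assembly

variable {T : ℕ}

/-- The top-free sum is non-negative. [cite: DuminilCopinHammond2013, §2.2 (bridge decomposition: bookkeeping of indices and pieces); lane plumbing] -/
theorem topFreeSumN_nonneg (T N : ℕ) : 0 ≤ topFreeSumN T N :=
  sum_nonneg fun _ _ => pow_nonneg hexCriticalFugacity_pos_lt_one.1.le _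

/-- The bottom-free sum is non-negative and non-decreasing in `y ≥ 0`. [cite: DuminilCopinHammond2013, §2.2 (bridge decomposition: bookkeeping of indices and pieces); lane plumbing] -/
theorem botFreeSumN_nonneg_mono (T N : ℕ) {y y' : ℝ} (hy : 0 ≤ y) (hyy' : y ≤ y') :
    0 ≤ botFreeSumN T N y ∧ botFreeSumN T N y ≤ botFreeSumN T N y' := by
  have hx := hexCriticalFugacity_pos_lt_one.1.le
  refine ⟨sum_nonneg fun _ _ => mul_nonneg (pow_nonneg hx _) (pow_nonneg hy _), sum_le_sum fun l _ => ?_⟩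
  exact mul_le_mul_of_nonneg_left (pow_le_pow_left₀ hy hyy' _) (pow_nonneg hx _)

/-- The width-`(T−1)` strip is subcritical at the threshold `y_T` of width `T` (`T ≥ 2`): `x_c ν_{T−1}(y_T) < 1`, because
`y_T < y_{T−1}`. [cite: BeatonBousquetMelouDeGierDuminilCopinGuttmann2014, Corollary 8 eq. (15) (y_{T+1} < y_T) and its proof (ν_T(y) < x_c⁻¹ iff y < y_T)] -/
theorem hexCriticalFugacity_mul_stripNu_pred_stripYT_lt_one (hT : 2 ≤ T) :
    hexCriticalFugacity * stripNu (T - 1) (stripYT T) < 1 := by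
  have hT1 : 1 ≤ T - 1 := by omega
  have hx := hexCriticalFugacity_pos_lt_one.1
  have hlt : stripYT T < stripYT (T - 1) := by
    have := stripYT_succ_lt hT1
    rwa [Nat.sub_add_cancel (by omega : 1 ≤ T)] at this
  have h := (stripNu_lt_inv_iff hT1 (stripYT_pos (by omega))).2 hlt
  calc hexCriticalFugacity * stripNu (T - 1) (stripYT T) < hexCriticalFugacity * hexCriticalFugacity⁻¹ :=
        mul_lt_mul_of_pos_left h hx
    _ = 1 := mul_inv_cancel₀ hx.ne'

/-- ★★ **The first-order bound of `B_T(x_c; ·)` at its threshold, reduced to horizontal bridges.**  Let `T ≥ 2`.  If the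
truncated horizontal-bridge series of the strip obey `D_N(y) ≤ C/(y_T − y)` for `1 ≤ y < y_T` uniformly in the truncation `N`
(the renewal structure of `HexSAWStripSurface…Renewal` / `Literature.Analysis.Matrix.NonnegMatrixFamilyNeumannBound`), then
`B_T(x_c; y) · (y_T − y) ≤ A` for `1 ≤ y < y_T` — the lane's statement (P), equivalent (THRESHOLD-LAW) to the boundedness of
`β_{T,m} y_T^m` and to the two-sided LINEAR law `B_{T,L}(x_c; y_T) ≍ L`.  Ingredients: the curtain lemma (top-free head,
bottom-free tail), `y_T < y_{T−1}`, and the subcriticality of the width-`(T−1)` strip.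
[cite: BeatonBousquetMelouDeGierDuminilCopinGuttmann2014, Corollary 8 (arXiv v5 p. 12: the radius of B_T(x_c, ·) is y_T); lane (MATHS-NOTE-k1-renewal [A]: the divergence ORDER at y_T)] -/
theorem stripByLim_mul_sub_le_of_hBridge_bound (hT : 2 ≤ T)
    (hHB : ∃ C : ℝ, ∀ N : ℕ, ∀ y : ℝ, 1 ≤ y → y < stripYT T → hBridgeSumN T N y ≤ C / (stripYT T - y)) :
    ∃ A : ℝ, ∀ y : ℝ, 1 ≤ y → y < stripYT T → stripByLim T y * (stripYT T - y) ≤ A := by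
  have hT1 : 1 ≤ T := by omega
  obtain ⟨C, hC⟩ := hHB
  obtain ⟨C₁, hC₁⟩ := exists_topFreeSumN_le hT1
  obtain ⟨C₃, hC₃⟩ := exists_botFreeSumN_le hT (one_lt_stripYT hT1).le (hexCriticalFugacity_mul_stripNu_pred_stripYT_lt_one hT)
  refine ⟨2 * (C₁ * C * C₃), fun y hy1 hyT => ?_⟩
  have hy0 : 0 ≤ y := by linarith
  have hpos : 0 < stripYT T - y := sub_pos.2 hyT
  have hC1' : 0 ≤ C₁ := (topFreeSumN_nonneg T 0).trans (hC₁ 0)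
  -- every box
  have hbox : ∀ L, stripGFy T L (IsBetaDart T) y ≤ 2 * (C₁ * C * C₃) / (stripYT T - y) := by
    intro L
    set N := (stripV T L).card
    have h1 := stripGFy_beta_le_two_mul hT1 hy0 (N := N) (L := L) (by omega)
    have hD := hC N y hy1 hyT
    have hD0 := hBridgeSumN_nonneg T N hy0
    have hF1 := hC₁ N
    have hF10 := topFreeSumN_nonneg T N
    obtain ⟨hF30, hF3m⟩ := botFreeSumN_nonneg_mono T N hy0 hyT.le
    have hF3 := hF3m.trans (hC₃ N)
    calc stripGFy T L (IsBetaDart T) y ≤ 2 * (topFreeSumN T N * hBridgeSumN T N y * botFreeSumN T N y) := h1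
      _ ≤ 2 * (C₁ * (C / (stripYT T - y)) * C₃) := by
          have h2 : topFreeSumN T N * hBridgeSumN T N y ≤ C₁ * (C / (stripYT T - y)) := mul_le_mul hF1 hD hD0 hC1'
          have h3 : topFreeSumN T N * hBridgeSumN T N y * botFreeSumN T N y ≤ C₁ * (C / (stripYT T - y)) * C₃ :=
            mul_le_mul h2 hF3 hF30 ((mul_nonneg hF10 hD0).trans h2)
          linarith
      _ = 2 * (C₁ * C * C₃) / (stripYT T - y) := by field_simp
  have hsup : stripByLim T y ≤ 2 * (C₁ * C * C₃) / (stripYT T - y) := ciSup_le hbox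
  calc stripByLim T y * (stripYT T - y) ≤ 2 * (C₁ * C * C₃) / (stripYT T - y) * (stripYT T - y) :=
        mul_le_mul_of_nonneg_right hsup hpos.le
    _ = 2 * (C₁ * C * C₃) := div_mul_cancel₀ _ hpos.ne'

end Assembly

end HV

end Literature.Probability.RandomPlanarGeometry.SAW

end
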